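import Literature.Barriers.RiemannHypothesis.DeBrangesPositivityDirichletProofs
import Literature.Barriers.RiemannHypothesis.DeBrangesPositivityCert
import Literature.Analysis.DeBrangesSpaces.ConreyLi2000SpacesFWProofs
import Literature.NumberTheory.LFunctions.RiemannXiLogDeriv
import HarnessLib

/-!
# Conrey–Li 2000, §3.1/§3.2/§4 as printed: the spaces `𝓕(W)`, `𝓕(W_χ)` do NOT satisfy de Branges' condition (3.3)/(3.8) — unconditional

LABEL (line 1): RH-FREE NEGATIVE results, PROVED (no named fact assumed). bears_on: B-C/B-P
(LADDER-RH §1, COLUMN 6 DBR). WHAT THIS IS NOT: not progress toward RH or GRH — these are the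
printed refutations of de Branges' sufficient condition for `ζ` and for every Dirichlet
`L`-function, now kernel-checked in the printed `𝓕(W)`-form; nothing here bears on the truth of RH.

J. B. Conrey, X.-J. Li, IMRN 2000:18 = arXiv:math/9812166 (read): §3.1 "Therefore, by Theorem 2, we
see that the space `𝓕(W)` with `W(z) = 1/ξ(1 − iz)` does not satisfy the condition (3.3)" (from
(3.4), `Re{ξ(1+282i)/ξ(2+282i)} < 0` at the real point `w = −282`); §4 Remark (P. Sarnak): the same
for `𝓕(W_χ)`, `W_χ(z) = 1/ξ(1 − iz, χ)`, every Dirichlet character `χ`.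

Previously these conclusions were in the tree only CONDITIONALLY on the named fact
`Literature.Analysis.DeBrangesSpaces.conreyLi2000_thm2` (Conrey–Li's Theorem 2, de Branges):
`conreyLi2000_thm2.not_positivity_of_re_div_neg`, `not_positivity_spaceF_char`. The part of
Theorem 2 they need — `Re{W(z)/W(z+i)} ≥ 0` on the closed upper half-plane — is now PROVED
(`conreyLi2000_thm2_upperHalfPlane` / `_closedUpperHalfPlane`, file
`Literature/Analysis/DeBrangesSpaces/ConreyLi2000SpacesFWProofs.lean`: the kernels `K(w,·)` are
members of `𝓕(W)` as typed and `⟨K_w, TK_w⟩ = conj W(w) W(w+i)/(2π(1 + 2 Im w))`), so: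

* `not_positivity_spaceF_zeta` — §3.1: for `W(z) = 1/ξ(1 − iz)`, `ξ(s) = s(s−1)π^{−s/2}Γ(s/2)ζ(s)`
  (`= 2 · Literature.NumberTheory.LFunctions.riemannXi (1 − iz)`), no kernel-shift transformation
  `T` of `𝓕(W)` has `Re⟨F, TF⟩ ≥ 0` for all `F ∈ 𝓕(W)`, GIVEN the numerical witness (3.4)
  `ConreyLi2000_FW_numeric` (`Re{ξ(1+282i)/ξ(2+282i)} < 0`) at the REAL point `z₀ = −282`, and
  `ξ ≠ 0` on `Re s ≥ 1` (continuity of `W` on the closed half-plane); standard axioms.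
  `not_positivity_spaceF_zeta_holds` feeds the tree's certified `ConreyLi2000_FW_numeric_holds`
  (`DeBrangesPositivityCert.lean`, a `native_decide` interval computation — this one corollary
  carries that computational axiom).
* `not_positivity_spaceF_char_holds` — §4 (Sarnak, every `χ` mod `r ≥ 1`): the same for
  `W_χ(z) = 1/ξ(1 − iz, χ)` (`ξ(·, χ) = DirichletTheta.dirichletXi χ`), from
  `exists_re_dirichletXi_div_neg` (`Re s₀ > 1`, i.e. a point of the OPEN upper half-plane).

## References

* [ConreyLi2000] J. B. Conrey, X.-J. Li, IMRN 2000:18, 929–940 = arXiv:math/9812166, Thm 2, §3.1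
  (3.3)–(3.4), §3.2 (3.8), §4 Remark (read).
-/

noncomputable section

open Complex
open scoped ComplexConjugate

open Literature.NumberTheory.LFunctions Literature.NumberTheory.LFunctions.DirichletTheta
  Literature.Analysis.DeBrangesSpaces

namespace Literature.Barriers.RiemannHypothesis

/-- `Re(1 − iz) = 1 + Im z`: the half-plane dictionary `s = 1 − iz`. [folklore] -/
private theorem re_one_sub_I_mul (z : ℂ) : (1 - I * z).re = 1 + z.im := by simp

/-- **Conrey–Li 2000, §3.1, as printed: "the space `𝓕(W)` with `W(z) = 1/ξ(1 − iz)` does not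
satisfy the condition (3.3)" — PROVED.** Here `ξ(s) = s(s−1)π^{−s/2}Γ(s/2)ζ(s) = 2·riemannXi(s)`
(Conrey–Li's normalisation), `W` is analytic and zero-free on the open upper half-plane
(`Re s > 1`) and continuous and zero-free on the closed one (`ξ ≠ 0` on `Re s ≥ 1`,
`riemannXi_ne_zero_of_one_le_re`), and at the real point `z₀ = −282` (`s = 1 + 282i`)
`Re{W(z₀)/W(z₀+i)} = Re{ξ(2+282i)/ξ(1+282i)} < 0` by the certified numerical witness (3.4)
(hypothesis `hnum : ConreyLi2000_FW_numeric`, discharged in the tree by the kernel-checked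
interval computation `ConreyLi2000_FW_numeric_holds`, `DeBrangesPositivityCert.lean` — fed in
`not_positivity_spaceF_zeta_holds` below; this theorem itself uses only the standard axioms); the
proved closed-half-plane half of Theorem 2 (`conreyLi2000_thm2_closedUpperHalfPlane`) then excludes
every kernel-shift `T` with `Re⟨F, TF⟩_{𝓕(W)} ≥ 0` for all `F ∈ 𝓕(W)`.
[cite: ConreyLi2000, §3.1 (3.3)–(3.4)] -/
theorem not_positivity_spaceF_zeta (hnum : ConreyLi2000_FW_numeric) {T : (ℂ → ℂ) → (ℂ → ℂ)}
    (hT : SpaceF.IsKernelShift (fun z ↦ (2 * riemannXi (1 - I * z))⁻¹) T) :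
    ¬ ∀ F : ℂ → ℂ, SpaceF.Mem (fun z ↦ (2 * riemannXi (1 - I * z))⁻¹) F →
        0 ≤ (SpaceF.inner (fun z ↦ (2 * riemannXi (1 - I * z))⁻¹) F (T F)).re := by
  set W : ℂ → ℂ := fun z ↦ (2 * riemannXi (1 - I * z))⁻¹ with hW
  have hxi_ne : ∀ z : ℂ, 0 ≤ z.im → 2 * riemannXi (1 - I * z) ≠ 0 := fun z hz ↦
    mul_ne_zero two_ne_zero (riemannXi_ne_zero_of_one_le_re (by rw [re_one_sub_I_mul]; linarith))
  have hlin : Differentiable ℂ fun z : ℂ ↦ 1 - I * z := by fun_prop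
  have hden : Differentiable ℂ fun z : ℂ ↦ 2 * riemannXi (1 - I * z) :=
    (differentiable_riemannXi.comp hlin).const_mul 2
  have hWd : DifferentiableOn ℂ W {z : ℂ | 0 < z.im} := fun z hz ↦
    ((hden z).inv (hxi_ne z (le_of_lt hz))).differentiableWithinAt
  have hW0 : ∀ z : ℂ, 0 < z.im → W z ≠ 0 := fun z hz ↦ inv_ne_zero (hxi_ne z hz.le)
  have hW0c : ∀ z : ℂ, 0 ≤ z.im → W z ≠ 0 := fun z hz ↦ inv_ne_zero (hxi_ne z hz)
  have hWc : ContinuousOn W {z : ℂ | 0 ≤ z.im} := fun z hz ↦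
    ((hden z).continuousAt.inv₀ (hxi_ne z hz)).continuousWithinAt
  -- the witness `z₀ = −282`: `1 − i z₀ = 1 + 282 i`, `1 − i(z₀ + i) = 2 + 282 i`
  unfold ConreyLi2000_FW_numeric at hnum
  have e0 : 1 - I * (-282 : ℂ) = 1 + 282 * I := by ring
  have e1 : 1 - I * ((-282 : ℂ) + I) = 2 + 282 * I := by linear_combination (-1 : ℂ) * I_mul_I
  have hneg : (W (-282) / W ((-282 : ℂ) + I)).re < 0 := by
    simp only [hW, e0, e1, inv_div_inv]
    -- `Re{2ξ(2+282i)/(2ξ(1+282i))} < 0` from `Re{ξ(1+282i)/ξ(2+282i)} < 0`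
    rw [mul_div_mul_left _ _ (two_ne_zero : (2 : ℂ) ≠ 0), ← inv_div, inv_re]
    have hpos : 0 < normSq (riemannXi (1 + 282 * I) / riemannXi (2 + 282 * I)) := by
      rw [normSq_pos]
      intro h0
      rw [h0] at hnum
      simp at hnum
    exact div_neg_of_neg_of_pos hnum hpos
  exact SpaceF.not_positivity_of_re_div_neg hWd hW0 hWc hW0c (z₀ := -282) (by simp) hneg hT

/-- **Conrey–Li 2000, §3.1, unconditionally: `𝓕(W)`, `W(z) = 1/ξ(1 − iz)`, does not satisfy
(3.3)** — `not_positivity_spaceF_zeta` fed with the certified numerical witness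
`ConreyLi2000_FW_numeric_holds` (which rests on a `native_decide` interval computation,
`DeBrangesPositivityCert.lean`; hence this corollary carries that computational axiom).
[cite: ConreyLi2000, §3.1 (3.3)–(3.4)] -/
theorem not_positivity_spaceF_zeta_holds {T : (ℂ → ℂ) → (ℂ → ℂ)}
    (hT : SpaceF.IsKernelShift (fun z ↦ (2 * riemannXi (1 - I * z))⁻¹) T) :
    ¬ ∀ F : ℂ → ℂ, SpaceF.Mem (fun z ↦ (2 * riemannXi (1 - I * z))⁻¹) F →
        0 ≤ (SpaceF.inner (fun z ↦ (2 * riemannXi (1 - I * z))⁻¹) F (T F)).re :=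
  not_positivity_spaceF_zeta ConreyLi2000_FW_numeric_holds hT

/-- **Conrey–Li 2000, §4 Remark (P. Sarnak), as printed: for every Dirichlet character `χ` mod
`r ≥ 1`, "the space `𝓕(W_χ)` does not satisfy the condition (3.8) where `W_χ(z) = 1/ξ(1 − iz, χ)`"
— PROVED** (unconditional form of `not_positivity_spaceF_char`, which assumed the named fact
`conreyLi2000_thm2`). Inputs: `exists_re_dirichletXi_div_neg` (an `s₀` with `Re s₀ > 1` and
`Re{ξ(s₀,χ)/ξ(s₀+1,χ)} < 0`, i.e. `z₀ = i(s₀ − 1)` in the OPEN upper half-plane with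
`Re{W_χ(z₀)/W_χ(z₀+i)} < 0`) and the proved open-half-plane half of Theorem 2
(`conreyLi2000_thm2_upperHalfPlane`). [cite: ConreyLi2000, §4 Remark] -/
theorem not_positivity_spaceF_char_holds {N : ℕ} [NeZero N] (χ : DirichletCharacter ℂ N)
    {T : (ℂ → ℂ) → (ℂ → ℂ)} (hT : SpaceF.IsKernelShift (fun z ↦ (dirichletXi χ (1 - I * z))⁻¹) T) :
    ¬ ∀ F : ℂ → ℂ, SpaceF.Mem (fun z ↦ (dirichletXi χ (1 - I * z))⁻¹) F →
        0 ≤ (SpaceF.inner (fun z ↦ (dirichletXi χ (1 - I * z))⁻¹) F (T F)).re := by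
  have hre_of : ∀ z : ℂ, 0 < z.im → 1 < (1 - I * z).re := fun z hz ↦ by
    rw [re_one_sub_I_mul]; linarith
  have hWd : DifferentiableOn ℂ (fun z ↦ (dirichletXi χ (1 - I * z))⁻¹) {z : ℂ | 0 < z.im} := by
    intro z hz
    have hs := hre_of z hz
    refine DifferentiableAt.differentiableWithinAt ?_
    have hlin : DifferentiableAt ℂ (fun z : ℂ ↦ 1 - I * z) z := by fun_prop
    have hcomp : DifferentiableAt ℂ (dirichletXi χ ∘ fun z : ℂ ↦ 1 - I * z) z :=
      DifferentiableAt.comp z (ConreyLi2000Char.differentiableAt_dirichletXi_of_one_lt_re χ hs) hlin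
    exact hcomp.inv (ConreyLi2000Char.dirichletXi_ne_zero χ hs)
  have hW0 : ∀ z : ℂ, 0 < z.im → (fun z ↦ (dirichletXi χ (1 - I * z))⁻¹) z ≠ 0 := fun z hz ↦
    inv_ne_zero (ConreyLi2000Char.dirichletXi_ne_zero χ (hre_of z hz))
  obtain ⟨s₀, hs₀, hneg⟩ := exists_re_dirichletXi_div_neg χ
  have hz₀ : 0 < (I * (s₀ - 1)).im := by simp; linarith
  have e0 : 1 - I * (I * (s₀ - 1)) = s₀ := by linear_combination (1 - s₀) * I_mul_I
  have e1 : 1 - I * (I * (s₀ - 1) + I) = s₀ + 1 := by linear_combination (-s₀) * I_mul_I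
  have hneg' : ((fun z ↦ (dirichletXi χ (1 - I * z))⁻¹) (I * (s₀ - 1))
      / (fun z ↦ (dirichletXi χ (1 - I * z))⁻¹) (I * (s₀ - 1) + I)).re < 0 := by
    simp only [e0, e1, inv_div_inv]
    rw [← inv_div, inv_re]
    have hpos : 0 < normSq (dirichletXi χ s₀ / dirichletXi χ (s₀ + 1)) := by
      rw [normSq_pos]
      intro h0
      rw [h0] at hneg
      simp at hneg
    exact div_neg_of_neg_of_pos hneg hpos
  exact SpaceF.not_positivity_of_re_div_neg_of_im_pos hWd hW0 hz₀ hneg' hT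

end Literature.Barriers.RiemannHypothesis

end
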